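import Literature.NumberTheory.LFunctions.Zhang2022.DetectorShiftClosedForm
import Literature.NumberTheory.LFunctions.Zhang2022.DetectorShiftDoubledParseval

/-!
# Where the shift-detector main-term form is NOT positive semidefinite: two explicit negative witnesses
# (sharpness of Lemma 2.3's box, kernel half)

Sub-cell E of the `landau-siegel` programme; companion to the DOUBLING/circle chain (`FormDetPSD (shiftRecipe b)` for
every sign-admissible `b`, `Det.formDetPSD_shiftRecipe_of_signAdmissible`; the two-sided `Det.DictShift` chain K2″/Id-7).
SHARPNESS (ls-barrier-num g3, HOME/barrier/num/TWO-SIDED-CIRCLE.md §7; PAPER THEOREM with float scan): for a sorted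
positive distinct triple `b` with `c₀(b) = Re ΣW_j(b) ≠ 0`, the two-sided windowed form `DictShift b` is PSD on profiles
IFF `b` is sign-admissible; the proof of «only if» is a dichotomy on the doubly-clamped bulk form `Q₀` of a unit interval.
This file lands the two EXPLICIT-WITNESS halves that need no spectral input:

* Part 1 — **`c₀(b) < 0` ⇒ `¬ FormDetPSD (shiftRecipe b)`** (`Det.not_formDetPSD_of_re_sum_shiftW_neg`): witness = the
  one-sided polynomial profile `g = −S′`, `S(y) = y²(1−y)²` (real, so the two `Im` terms of the bulk form vanish and
  `T_b(S) = ∫S″² + π²e₂∫S′² = 4/5 + (2/105)π²e₂ > 0`; jets `∫g = g(0) = 0` kill the free-end form; K1 gives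
  `(π/2)·𝔅_{R(b)}(g) = c₀·T_b(S) < 0`). Hypotheses: `b` injective, `e₂(b) ≥ 0` (true for positive shifts).
* Part 2 — **case (B) of the dichotomy** (`Det.not_formDetPSD_of_clampedNegWitness`): if `c₀(b) > 0` and SOME doubly-clamped
  `φ` on `[0,1]` (continuous `φ, φ′`, right-derivatives, `φ″ ∈ L²`, all four end jets zero) has `T_b^([0,1])(φ) < 0`, then
  `g = −φ′` is a one-sided kinked profile with `(π/2)·𝔅_{R(b)}(g) = c₀·T_b(φ) < 0`, so `¬ FormDetPSD (shiftRecipe b)`.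

Case (A) of the dichotomy (`Q₀ ⪰ 0` ⇒ the twist profile `G = −iπm₀e^(iπm₀y)` at a lattice point with `σ_b(m₀) < 0` has
`DictShift b G < 0`, via minimality of the two-point bridge) is the successor item «K8b» (memo §7); not here.
Nothing here asserts anything about `L`-functions. 0 facts, 0 sorries.
«The programme SEARCHES and TYPES; no claim about Landau–Siegel zeros, Theorems 1–2 of arXiv:2211.02515 or a repaired
Margin232 until a kernel theorem says so.» -/

noncomputable section

open Complex Real ComplexConjugate Set MeasureTheory intervalIntegral

namespace Literature.NumberTheory.LFunctions.Zhang2022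

namespace Det

open Repair

variable {b : Fin 3 → ℝ}

/-! ### Part 1 — a real doubly-clamped bump: `c₀ < 0` forces a negative value -/

/-- The bump `S(y) = y²(1−y)²` (as a complex-valued function). [cite: Zhang2022LandauSiegel, Prop 7.1 p.44 with (7.2)] -/
def bumpS (y : ℝ) : ℂ := (((y * y * ((1 - y) * (1 - y)) : ℝ)) : ℂ)

/-- `S′(y) = 2y − 6y² + 4y³`. [cite: Zhang2022LandauSiegel, Prop 7.1 p.44 with (7.2)] -/
def bumpS1 (y : ℝ) : ℂ := (((2 * y - 6 * (y * y) + 4 * (y * y * y) : ℝ)) : ℂ)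

/-- `S″(y) = 2 − 12y + 12y²`. [cite: Zhang2022LandauSiegel, Prop 7.1 p.44 with (7.2)] -/
def bumpS2 (y : ℝ) : ℂ := (((2 - 12 * y + 12 * (y * y) : ℝ)) : ℂ)

/-- `S‴(y) = −12 + 24y`. [cite: Zhang2022LandauSiegel, Prop 7.1 p.44 with (7.2)] -/
def bumpS3 (y : ℝ) : ℂ := (((-12 + 24 * y : ℝ)) : ℂ)

/-- The witness profile `g = −S′` and its derivative `g′ = −S″`. [cite: Zhang2022LandauSiegel, Prop 7.1 p.44 with (7.2)] -/
def bumpProfile (y : ℝ) : ℂ := -bumpS1 y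

/-- `g′ = −S″`. [cite: Zhang2022LandauSiegel, Prop 7.1 p.44 with (7.2)] -/
def bumpProfile' (y : ℝ) : ℂ := -bumpS2 y

/-- `S` has derivative `S′`. [folklore] -/
private theorem hasDerivAt_bumpS (y : ℝ) : HasDerivAt bumpS (bumpS1 y) y := by
  have h : HasDerivAt (fun y : ℝ => y * y * ((1 - y) * (1 - y))) (2 * y - 6 * (y * y) + 4 * (y * y * y)) y := by
    have h1 := (hasDerivAt_id y).mul (hasDerivAt_id y)
    have h2 := ((hasDerivAt_id y).const_sub 1).mul ((hasDerivAt_id y).const_sub 1)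
    exact (h1.mul h2).congr_deriv (by simp only [id, Pi.mul_apply]; ring)
  exact h.ofReal_comp

/-- `S′` has derivative `S″`. [folklore] -/
private theorem hasDerivAt_bumpS1 (y : ℝ) : HasDerivAt bumpS1 (bumpS2 y) y := by
  have h : HasDerivAt (fun y : ℝ => 2 * y - 6 * (y * y) + 4 * (y * y * y)) (2 - 12 * y + 12 * (y * y)) y := by
    have h1 := (hasDerivAt_id y).const_mul (2:ℝ)
    have h2 := ((hasDerivAt_id y).mul (hasDerivAt_id y)).const_mul (6:ℝ)
    have h3 := (((hasDerivAt_id y).mul (hasDerivAt_id y)).mul (hasDerivAt_id y)).const_mul (4:ℝ)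
    exact ((h1.sub h2).add h3).congr_deriv (by simp only [id, Pi.mul_apply]; ring)
  exact h.ofReal_comp

/-- `S″` has derivative `S‴`. [folklore] -/
private theorem hasDerivAt_bumpS2 (y : ℝ) : HasDerivAt bumpS2 (bumpS3 y) y := by
  have h : HasDerivAt (fun y : ℝ => 2 - 12 * y + 12 * (y * y)) (-12 + 24 * y) y := by
    have h1 := ((hasDerivAt_id y).const_mul (12:ℝ)).const_sub 2
    have h2 := ((hasDerivAt_id y).mul (hasDerivAt_id y)).const_mul (12:ℝ)
    exact (h1.add h2).congr_deriv (by simp only [id]; ring)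
  exact h.ofReal_comp

/-- The witness is a kinked (indeed smooth) profile. [cite: Zhang2022LandauSiegel, Prop 7.1 p.44 with (7.2)] -/
theorem kinkedProfile_bumpProfile : KinkedProfile bumpProfile bumpProfile' := by
  have hc : Continuous bumpProfile :=
    (continuous_iff_continuousAt.2 fun y => (hasDerivAt_bumpS1 y).continuousAt).neg
  have hc' : Continuous bumpProfile' :=
    (continuous_iff_continuousAt.2 fun y => (hasDerivAt_bumpS2 y).continuousAt).neg
  refine ⟨hc.continuousOn, fun x _ => ((hasDerivAt_bumpS1 x).neg).hasDerivWithinAt, ?_⟩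
  exact memLp_two_of_continuousOn_Icc' hc'.continuousOn

/-- `g(1) = 0` (one-sided). [cite: Zhang2022LandauSiegel, Prop 7.1 p.44 with (7.2)] -/
theorem bumpProfile_one : bumpProfile 1 = 0 := by
  unfold bumpProfile bumpS1; push_cast; ring

/-- `g(0) = 0`. [cite: Zhang2022LandauSiegel, Prop 7.1 p.44 with (7.2)] -/
theorem bumpProfile_zero : bumpProfile 0 = 0 := by
  unfold bumpProfile bumpS1; push_cast; ring

/-- `∫₀¹ g = −(S(1) − S(0)) = 0`. [cite: Zhang2022LandauSiegel, Prop 7.1 p.44 with (7.2)] -/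
theorem integral_bumpProfile : ∫ y in (0:ℝ)..1, bumpProfile y = 0 := by
  unfold bumpProfile
  rw [intervalIntegral.integral_neg, intervalIntegral.integral_eq_sub_of_hasDerivAt
    (fun y _ => hasDerivAt_bumpS y) ((continuous_iff_continuousAt.2 fun y =>
      (hasDerivAt_bumpS1 y).continuousAt).intervalIntegrable 0 1)]
  unfold bumpS; push_cast; ring

/-- The tail primitive of the witness is the bump itself: `∫_y^1 g = S(y)` (since `S(1) = 0`).
[cite: Zhang2022LandauSiegel, Prop 7.1 p.44 with (7.2)] -/
theorem tailPrim_bumpProfile (y : ℝ) : tailPrim bumpProfile y = bumpS y := by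
  unfold tailPrim bumpProfile
  rw [intervalIntegral.integral_neg, intervalIntegral.integral_eq_sub_of_hasDerivAt
    (fun t _ => hasDerivAt_bumpS t) ((continuous_iff_continuousAt.2 fun t =>
      (hasDerivAt_bumpS1 t).continuousAt).intervalIntegrable y 1)]
  unfold bumpS; push_cast; ring

/-- **The bulk energy of the real bump:** `T_b^([0,1])(S) = 4/5 + (2/105)·π²e₂(b)` (the `Im` terms vanish on real data).
[cite: Zhang2022LandauSiegel, Prop 7.1 p.44 with (8.11)–(8.23)] -/
theorem bulkFormOn_bump (b : Fin 3 → ℝ) :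
    bulkFormOn b 0 1 (tailPrim bumpProfile) (fun y => -bumpProfile y) (fun y => -bumpProfile' y)
      = 4 / 5 + 2 / 105 * (π ^ 2 * (b 0 * b 1 + b 1 * b 2 + b 2 * b 0)) := by
  unfold bulkFormOn
  have hpt : ∀ y ∈ uIcc (0:ℝ) 1,
      (‖-bumpProfile' y‖ ^ 2 + π * (b 0 + b 1 + b 2) * ((-bumpProfile' y) * conj (-bumpProfile y)).im
        + π ^ 2 * (b 0 * b 1 + b 1 * b 2 + b 2 * b 0) * ‖-bumpProfile y‖ ^ 2
        + π ^ 3 * (b 0 * b 1 * b 2) * ((-bumpProfile y) * conj (tailPrim bumpProfile y)).im)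
      = (2 - 12 * y + 12 * (y * y)) ^ 2
        + π ^ 2 * (b 0 * b 1 + b 1 * b 2 + b 2 * b 0) * (2 * y - 6 * (y * y) + 4 * (y * y * y)) ^ 2 := by
    intro y _
    rw [tailPrim_bumpProfile]
    unfold bumpProfile bumpProfile' bumpS bumpS1 bumpS2
    simp only [neg_neg, Complex.conj_ofReal, ← Complex.ofReal_mul, Complex.ofReal_im, mul_zero, add_zero,
      Complex.norm_real, Real.norm_eq_abs, sq_abs]
  rw [intervalIntegral.integral_congr hpt]
  have hF : ∀ y ∈ uIcc (0:ℝ) 1, HasDerivAt (fun y : ℝ =>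
      (4 * y - 24 * (y * y) + 64 * (y * y * y) - 72 * (y * y * y * y) + 144 / 5 * (y * y * y * y * y))
        + π ^ 2 * (b 0 * b 1 + b 1 * b 2 + b 2 * b 0) *
          (4 / 3 * (y * y * y) - 6 * (y * y * y * y) + 52 / 5 * (y * y * y * y * y)
            - 8 * (y * y * y * y * y * y) + 16 / 7 * (y * y * y * y * y * y * y)))
      ((2 - 12 * y + 12 * (y * y)) ^ 2
        + π ^ 2 * (b 0 * b 1 + b 1 * b 2 + b 2 * b 0) * (2 * y - 6 * (y * y) + 4 * (y * y * y)) ^ 2) y := by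
    intro y _
    have i := hasDerivAt_id y
    have p2 := i.mul i
    have p3 := p2.mul i
    have p4 := p3.mul i
    have p5 := p4.mul i
    have p6 := p5.mul i
    have p7 := p6.mul i
    have hA := ((((i.const_mul (4:ℝ)).sub (p2.const_mul (24:ℝ))).add (p3.const_mul (64:ℝ))).sub
      (p4.const_mul (72:ℝ))).add (p5.const_mul (144 / 5 : ℝ))
    have hB := (((((p3.const_mul (4 / 3 : ℝ)).sub (p4.const_mul (6:ℝ))).add (p5.const_mul (52 / 5 : ℝ))).sub
      (p6.const_mul (8:ℝ))).add (p7.const_mul (16 / 7 : ℝ))).const_mul (π ^ 2 * (b 0 * b 1 + b 1 * b 2 + b 2 * b 0))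
    exact (hA.add hB).congr_deriv (by simp only [id, Pi.mul_apply]; ring)
  have hint : IntervalIntegrable (fun y : ℝ => (2 - 12 * y + 12 * (y * y)) ^ 2
      + π ^ 2 * (b 0 * b 1 + b 1 * b 2 + b 2 * b 0) * (2 * y - 6 * (y * y) + 4 * (y * y * y)) ^ 2) volume 0 1 := by
    apply Continuous.intervalIntegrable; fun_prop
  rw [intervalIntegral.integral_eq_sub_of_hasDerivAt hF hint]
  ring

/-- **`c₀(b) < 0` ⇒ the one-sided form of the shift recipe is NOT positive semidefinite** (explicit witness `g = −S′`,
`S = y²(1−y)²`: `(π/2)·𝔅_{R(b)}(g) = c₀(b)·(4/5 + (2/105)π²e₂) < 0`). Hypotheses: `b` with distinct entries and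
`e₂(b) ≥ 0` (every positive triple). Outside `{c₀ > 0}` no detector of the shift family has a PSD main-term form —
the component map of H-CLOSED-FORM §8 as a theorem on `{c₀ < 0}`. [cite: Zhang2022LandauSiegel, §2 Lemma 2.3; Prop 7.1 p.44 with (7.2), (8.11)–(8.23)] -/
theorem not_formDetPSD_of_re_sum_shiftW_neg (hb : Function.Injective b)
    (he2 : 0 ≤ b 0 * b 1 + b 1 * b 2 + b 2 * b 0) (hc : (∑ j : Fin 3, shiftW b j).re < 0) :
    ¬ FormDetPSD (shiftRecipe b) := by
  intro hpsd
  have h0 := hpsd bumpProfile bumpProfile' kinkedProfile_bumpProfile bumpProfile_one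
  have hK1 := formDet_shiftRecipe_eq_bulk_add_freeEnd hb kinkedProfile_bumpProfile bumpProfile_one
  rw [integral_bumpProfile, bumpProfile_zero, neg_zero, bulkFormOn_bump] at hK1
  have hfe : freeEndForm b 0 0 = 0 := by unfold freeEndForm; simp
  rw [hfe, add_zero] at hK1
  have hpos : 0 < 4 / 5 + 2 / 105 * (π ^ 2 * (b 0 * b 1 + b 1 * b 2 + b 2 * b 0)) := by positivity
  have hπ : 0 < π / 2 := by positivity
  nlinarith [mul_neg_of_neg_of_pos hc hpos, mul_nonneg hπ.le h0]

/-! ### Part 2 — case (B) of the dichotomy: a doubly-clamped function of negative bulk energy -/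

variable {φ φ' φ'' : ℝ → ℂ}

/-- **Case (B): a doubly-clamped `φ` with `T_b^([0,1])(φ) < 0` and `c₀(b) > 0` ⇒ `¬ FormDetPSD (shiftRecipe b)`**, witness
`g = −φ′` (one-sided: `g(1) = −φ′(1) = 0`; jets `∫g = φ(0) − φ(1) = 0`, `g(0) = −φ′(0) = 0` kill the free-end form;
`tailPrim g = φ`). [cite: Zhang2022LandauSiegel, §2 Lemma 2.3; Prop 7.1 p.44 with (7.2), (8.11)–(8.23)] -/
theorem not_formDetPSD_of_clampedNegWitness (hb : Function.Injective b) (hc : 0 < (∑ j : Fin 3, shiftW b j).re)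
    (hφc : ContinuousOn φ (Icc 0 1)) (hφ'c : ContinuousOn φ' (Icc 0 1))
    (hφd : ∀ y ∈ Ioo (0:ℝ) 1, HasDerivWithinAt φ (φ' y) (Ioi y) y)
    (hφ'd : ∀ y ∈ Ioo (0:ℝ) 1, HasDerivWithinAt φ' (φ'' y) (Ioi y) y)
    (hφ''m : MemLp φ'' 2 (volume.restrict (Ioc (0:ℝ) 1)))
    (h0 : φ 0 = 0) (h1 : φ 1 = 0) (h0' : φ' 0 = 0) (h1' : φ' 1 = 0)
    (hneg : bulkFormOn b 0 1 φ φ' φ'' < 0) :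
    ¬ FormDetPSD (shiftRecipe b) := by
  intro hpsd
  -- the witness and its kinked-profile structure
  have hK : KinkedProfile (fun y => -φ' y) (fun y => -φ'' y) :=
    ⟨hφ'c.neg, fun x hx => (hφ'd x hx).neg, hφ''m.neg⟩
  have hg1 : (fun y => -φ' y) 1 = 0 := by simp [h1']
  have hval := hpsd _ _ hK hg1
  have hK1 := formDet_shiftRecipe_eq_bulk_add_freeEnd hb hK hg1
  -- FTC for the right-differentiable `φ`: `∫_y^1 φ′ = φ 1 − φ y`
  have hφ'i : IntervalIntegrable φ' volume 0 1 := hφ'c.intervalIntegrable_of_Icc zero_le_one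
  have hFTC : ∀ y ∈ Icc (0:ℝ) 1, ∫ t in y..(1:ℝ), φ' t = φ 1 - φ y := by
    intro y hy
    have hsub : Icc y 1 ⊆ Icc (0:ℝ) 1 := Icc_subset_Icc hy.1 le_rfl
    refine intervalIntegral.integral_eq_sub_of_hasDeriv_right_of_le hy.2 (hφc.mono hsub) ?_
      (hφ'i.mono_set (by rw [uIcc_of_le hy.2, uIcc_of_le zero_le_one]; exact hsub))
    intro x hx
    exact hφd x ⟨lt_of_le_of_lt hy.1 hx.1, hx.2⟩
  have hint0 : ∫ y in (0:ℝ)..1, (fun y => -φ' y) y = 0 := by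
    simp only [intervalIntegral.integral_neg]
    rw [hFTC 0 (left_mem_Icc.2 zero_le_one), h1, h0]; simp
  have htail : ∀ y ∈ uIcc (0:ℝ) 1, tailPrim (fun y => -φ' y) y = φ y := by
    intro y hy
    rw [uIcc_of_le zero_le_one] at hy
    unfold tailPrim
    simp only [intervalIntegral.integral_neg]
    rw [hFTC y hy, h1]; simp
  -- the bulk form only sees `[0,1]`, where `tailPrim g = φ`
  have hbulk : bulkFormOn b 0 1 (tailPrim fun y => -φ' y) (fun y => -(fun y => -φ' y) y)
      (fun y => -(fun y => -φ'' y) y) = bulkFormOn b 0 1 φ φ' φ'' := by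
    unfold bulkFormOn
    refine intervalIntegral.integral_congr fun y hy => ?_
    simp only [neg_neg, htail y hy]
  rw [hint0, hbulk] at hK1
  have hfe : freeEndForm b 0 (-(fun y => -φ' y) 0) = 0 := by
    simp only [h0', neg_zero]; unfold freeEndForm; simp
  rw [hfe, add_zero] at hK1
  have hπ : 0 < π / 2 := by positivity
  nlinarith [mul_neg_of_pos_of_neg hc hneg, mul_nonneg hπ.le hval]

end Det

end Literature.NumberTheory.LFunctions.Zhang2022
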